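/- Copyright: ym3-torus cell, WIDTH-5 ATTACH seat `ym-ust-19936-w4` (prover, g10), for crux `HistoryTailL` (stmt-QuantumFields-19936),
level-0 prefactor-free infrastructure (T2d) of LINE `local_insertion` (#13) ∕ K1.  Released under the licence of the surrounding project. -/
import Literature.MathematicalPhysics.QuantumFieldTheory.SU2WilsonCharacterCoefficients
import Literature.Probability.LatticeModels.BesselIDebyeAsymptotics
import HarnessLib

/-!
# The one-link Gaussian bound on `SU(2)`: `∫ exp(−β′(2 − Re tr W)) dW ≤ 8·β′^{−3∕2}` (`β′ ≥ 1`)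

Support file (`--supports stmt-QuantumFields-19936 --as helper`), step (T2d) of the cell's level-0 PREFACTOR-FREE plan (LEAD
★w1-19936 g7 00:09:18Z): the one-link factor `z_{SU(2)}(β′)` of the triangular upper bound
✓`TriangularPlaquette.lintegral_exp_neg_mul_wilsonAction_le` (`Z_π(β′) ≤ z(β′)^{2n³ − n² − n}`) has the SHARP Gaussian
exponent `3∕2 = dim SU(2)∕2`, so that the free-energy sandwich of the door ✓`WilsonPlaquetteExpMomentSandwich` loses no power
of `β` per plaquette.

HOW (all in the tree, by name).  `∫_{SU(2)} e^{B Re tr W} dW = I₁(2B)∕B`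
(✓`SU2OneLink.integral_exp_mul_re_trace_eq_besselI`, [MontvayMunster1994] (3.173)); `I₁ ≤ I₀` (✓`besselI_succ_le`); the
Debye∕Laplace bracket `I₀(x) ≤ (1 + 50∕x)·eˣ∕√(2πx)` (✓`Probability.LatticeModels.besselI_mem_Icc_debye` at `n = 0`,
[FrohlichSpencerKT1981] App. B); hence
`z(β′) = e^{−2β′}·I₁(2β′)∕β′ ≤ (1 + 25∕β′)∕(2√π · β′√β′) ≤ 8∕(β′√β′)` for `β′ ≥ 1`.

WHAT.  `besselI_zero_le_debye` (the `n = 0` upper Debye bound in `FunctionSpaces.besselI` letters),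
`integral_exp_neg_mul_actionTerm_su2_eq` (`z(β′) = e^{−2β′} I₁(2β′)∕β′`), ★`integral_exp_neg_mul_actionTerm_su2_le` (the explicit
bound for every `β′ > 0`) and ★`integral_exp_neg_mul_actionTerm_su2_le_of_one_le` (`≤ 8∕(β′√β′)` for `β′ ≥ 1`), plus the
`fundamentalRep (Fin 2)` reading `integral_exp_neg_mul_actionTerm_fundamentalRep_le` matching the bridge
✓`T3FinestHeightTail.gibbsMeasure_real_eq_wilsonMeasure_real` (`ρ := fundamentalRep (Fin 2)`, coupling `β∕2`).

HONEST SCOPE.  One-variable calculus over tree theorems; nothing of the sandwich's lower half (T1′), of the exponential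
moment (EM), of LINE #13's stubs, of `HistoryTailL` or of any crux is proved.  YM₃ on T³ is rung R3 — not d = 4, not infinite
volume, not a mass gap, not Clay.
-/

namespace Summit.QuantumFields.YangMills.Theorems.LocalInsertion.OneLinkGaussianSU2

open MeasureTheory Real
open Literature.MathematicalPhysics.QuantumFieldTheory
open Literature.Analysis.FunctionSpaces (besselI besselI_eq_latticeModels_besselI besselI_succ_le)

noncomputable section

/-- **THE UPPER DEBYE BOUND AT ORDER ZERO**: `I₀(x) ≤ (1 + 50∕x) · eˣ ∕ √(2πx)` for `x > 0`. [cite: FrohlichSpencerKT1981, Appendix B (B.12)] -/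
theorem besselI_zero_le_debye {x : ℝ} (hx : 0 < x) :
    besselI 0 x ≤ (1 + 50 / x) * (Real.exp x / √(2 * π * x)) := by
  have h := (Literature.Probability.LatticeModels.besselI_mem_Icc_debye hx 0).2
  have hs : √(x ^ 2 + ((0 : ℤ) : ℝ) ^ 2) = x := by
    rw [Int.cast_zero, zero_pow two_ne_zero, add_zero, Real.sqrt_sq hx.le]
  rw [hs] at h
  simp only [Int.cast_zero, zero_mul, sub_zero] at h
  rw [besselI_eq_latticeModels_besselI, Nat.cast_zero]
  exact h

/-- **THE ONE-LINK INTEGRAL IN CLOSED FORM**: `∫_{SU(2)} exp(−β′(2 − Re tr W)) dW = e^{−2β′}·I₁(2β′)∕β′` for `β′ ≠ 0`.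
[cite: MontvayMunster1994, §3.2.5 (3.173) p.128] -/
theorem integral_exp_neg_mul_actionTerm_su2_eq {β' : ℝ} (hβ' : β' ≠ 0) :
    ∫ W, Real.exp (-β' * ((2 : ℝ) - ((W : Matrix (Fin 2) (Fin 2) ℂ).trace).re))
        ∂(haarProbability (Matrix.specialUnitaryGroup (Fin 2) ℂ)) =
      Real.exp (-(2 * β')) * (besselI 1 (2 * β') / β') := by
  have hpt : ∀ W : Matrix.specialUnitaryGroup (Fin 2) ℂ,
      Real.exp (-β' * ((2 : ℝ) - ((W : Matrix (Fin 2) (Fin 2) ℂ).trace).re)) =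
        Real.exp (-(2 * β')) * Real.exp (β' * ((W : Matrix (Fin 2) (Fin 2) ℂ).trace).re) := by
    intro W
    rw [← Real.exp_add]
    congr 1
    ring
  simp_rw [hpt]
  rw [integral_const_mul, SU2OneLink.integral_exp_mul_re_trace_eq_besselI β' hβ']

/-- **THE ONE-LINK GAUSSIAN BOUND, explicit**: for `β′ > 0`,
`∫_{SU(2)} exp(−β′(2 − Re tr W)) dW ≤ (1 + 25∕β′) ∕ (2·√π·(β′·√β′))` — the sharp power `β′^{−3∕2}`. [folklore] -/
theorem integral_exp_neg_mul_actionTerm_su2_le {β' : ℝ} (hβ' : 0 < β') :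
    ∫ W, Real.exp (-β' * ((2 : ℝ) - ((W : Matrix (Fin 2) (Fin 2) ℂ).trace).re))
        ∂(haarProbability (Matrix.specialUnitaryGroup (Fin 2) ℂ)) ≤
      (1 + 25 / β') / (2 * √π * (β' * √β')) := by
  rw [integral_exp_neg_mul_actionTerm_su2_eq hβ'.ne']
  have h2β : 0 < 2 * β' := by positivity
  -- `I₁(2β′) ≤ I₀(2β′) ≤ (1 + 25∕β′)·e^{2β′}∕√(4πβ′)`
  have hI1 : besselI 1 (2 * β') ≤ besselI 0 (2 * β') := besselI_succ_le 0 h2β.le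
  have hI0 := besselI_zero_le_debye h2β
  have h50 : 1 + 50 / (2 * β') = 1 + 25 / β' := by
    congr 1
    field_simp
    norm_num
  rw [h50] at hI0
  have hsqrt : √(2 * π * (2 * β')) = 2 * √π * √β' := by
    rw [show 2 * π * (2 * β') = (2 * 2) * (π * β') by ring, Real.sqrt_mul (by norm_num),
      Real.sqrt_mul_self zero_le_two, Real.sqrt_mul Real.pi_pos.le, mul_assoc]
  rw [hsqrt] at hI0
  have hden : 0 < 2 * √π * √β' := by positivity
  have hc : 0 ≤ 1 + 25 / β' := by positivity
  -- assemble
  calc Real.exp (-(2 * β')) * (besselI 1 (2 * β') / β')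
      ≤ Real.exp (-(2 * β')) * ((1 + 25 / β') * (Real.exp (2 * β') / (2 * √π * √β')) / β') := by
        gcongr
        exact hI1.trans hI0
    _ = (1 + 25 / β') / (2 * √π * (β' * √β')) := by
        rw [show Real.exp (-(2 * β')) * ((1 + 25 / β') * (Real.exp (2 * β') / (2 * √π * √β')) / β') =
            (Real.exp (-(2 * β')) * Real.exp (2 * β')) * (1 + 25 / β') / (2 * √π * √β' * β') by
          field_simp]
        rw [← Real.exp_add, neg_add_cancel, Real.exp_zero, one_mul]
        congr 1
        ring

/-- **THE ONE-LINK GAUSSIAN BOUND**: for `β′ ≥ 1`, `∫_{SU(2)} exp(−β′(2 − Re tr W)) dW ≤ 8 ∕ (β′·√β′)` (`= 8·β′^{−3∕2}`;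
`(1 + 25)∕(2√π) < 8` since `π > (13∕8)²`). [folklore] -/
theorem integral_exp_neg_mul_actionTerm_su2_le_of_one_le {β' : ℝ} (hβ' : 1 ≤ β') :
    ∫ W, Real.exp (-β' * ((2 : ℝ) - ((W : Matrix (Fin 2) (Fin 2) ℂ).trace).re))
        ∂(haarProbability (Matrix.specialUnitaryGroup (Fin 2) ℂ)) ≤ 8 / (β' * √β') := by
  have hβ'0 : 0 < β' := lt_of_lt_of_le one_pos hβ'
  refine (integral_exp_neg_mul_actionTerm_su2_le hβ'0).trans ?_
  have hnum : 1 + 25 / β' ≤ 26 := by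
    have : 25 / β' ≤ 25 := by
      rw [div_le_iff₀ hβ'0]; nlinarith
    linarith
  have hpi : (13 : ℝ) / 8 ≤ √π := by
    rw [Real.le_sqrt (by norm_num) Real.pi_pos.le]
    nlinarith [Real.pi_gt_three]
  have hden : 0 < β' * √β' := by positivity
  rw [div_le_div_iff₀ (by positivity) hden]
  -- `(1 + 25∕β′)·(β′√β′) ≤ 8·(2√π·(β′√β′))`
  have h26 : (1 + 25 / β') * (β' * √β') ≤ 26 * (β' * √β') := mul_le_mul_of_nonneg_right hnum hden.le
  have h8 : 26 * (β' * √β') ≤ 8 * (2 * √π * (β' * √β')) := by nlinarith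
  exact h26.trans h8

/-- **THE ONE-LINK GAUSSIAN BOUND in the bridge's letters** (`ρ := fundamentalRep (Fin 2)` of
✓`T3FinestHeightTail.gibbsMeasure_real_eq_wilsonMeasure_real`, `N = 2`): for `β′ ≥ 1`,
`∫ exp(−β′(2 − Re tr (fundamentalRep (Fin 2)) W)) dHaar ≤ 8 ∕ (β′·√β′)`. [folklore] -/
theorem integral_exp_neg_mul_actionTerm_fundamentalRep_le {β' : ℝ} (hβ' : 1 ≤ β') :
    ∫ W, Real.exp (-β' * (((2 : ℕ) : ℝ) -
        ((Literature.MathematicalPhysics.QuantumLattice.fundamentalRep (Fin 2) W).trace).re))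
        ∂(haarProbability (Matrix.specialUnitaryGroup (Fin 2) ℂ)) ≤ 8 / (β' * √β') := by
  simp only [Literature.MathematicalPhysics.QuantumLattice.fundamentalRep_apply, Nat.cast_ofNat]
  exact integral_exp_neg_mul_actionTerm_su2_le_of_one_le hβ'

end

end Summit.QuantumFields.YangMills.Theorems.LocalInsertion.OneLinkGaussianSU2
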